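import Summits.Ventures.HodgeRepro2.T5SU11SphericalTransformCartan
import Summits.Ventures.HodgeRepro2.T5SU11SphericalTransform

/-!
# The convolution theorem for the spherical transform: `(f ∗ g)^(λ) = f̂(λ) ĝ(λ)` for bi-`K`-invariant
`f, g` — the Gelfand pair `(SU(1,1), K)`

For bi-`K`-invariant `f, g ∈ L¹(ν)` (continuous) and `0 ≤ λ ≤ 2`, the convolution
`(f ∗ g)(x) = ∫_G f(y) g(y⁻¹ x) dν(y)` has spherical transform the PRODUCT of the transforms:
**`∫_G (f ∗ g)(x) φ_λ(x) dν(x) = (∫_G f φ_λ dν) (∫_G g φ_λ dν)`** (`integral_convolution_mul_sph`).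
Ingredients: a bi-`K`-invariant function is inversion-invariant (`biRotInvariant_inv`: `T(x⁻¹) = T(x)`),
so `∫_G g(x) φ_λ(y x) dν(x) = ∫_G g(x) φ_λ(y x⁻¹) dν(x)`, which is the eigen-identity of
`T5SU11SphericalTransform` in its right-invariant form: `= ĝ(λ) φ_λ(y)` (`integral_mul_sph_mul`); the
convolution integrand `(y, x) ↦ f(y) g(y⁻¹x) φ_λ(x)` is integrable on `G × G` (Fubini's criterion with
the sections as left translates, `integrable_convolution_integrand`), and Fubini plus the left invariance
of `ν` finish. Consequently the transforms of `f ∗ g` and `g ∗ f` agree (`integral_convolution_mul_sph_comm`)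
— the commutativity of the bi-`K`-invariant convolution algebra at the level of the spherical transform.
Nothing is claimed about (N).

Blind lane: Mathlib + the HodgeRepro2 prefix only; no sorry; axioms ⊆ {propext, Classical.choice,
Quot.sound}.
-/

namespace Summit.Ventures.HodgeRepro2.T5SU11SphericalConvolution

open MeasureTheory MeasureTheory.Measure Metric Set Filter Topology
open T5SU11Unimodular T5SU11Fibration T5SU11Cartan T5SU11OneParameter T5SU11CartanProjection
  T5HaarCircle T5BergmanCoefficient T5SU11FibrationHaar T5SU11SphericalFunction
  T5SU11SphericalBounds T5SU11SphericalContinuous T5SU11SphericalIntegral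
  T5SU11SphericalTransform T5SU11SphericalTransformCartan
open scoped Real

/-! ### Bi-`K`-invariant functions are inversion-invariant -/

/-- **A bi-`K`-invariant function is inversion-invariant**: `f x⁻¹ = f x` (Cartan decomposition and
`T(x⁻¹) = T(x)`). -/
theorem biRotInvariant_inv {f : SU11 → ℝ} (hK : ∀ (u v : Circle) (g : SU11), f (rot u * g * rot v) = f g)
    (x : SU11) : f x⁻¹ = f x := by
  rw [biRotInvariant_eq hK x⁻¹, biRotInvariant_eq hK x]
  have h := cartanT_inv x
  unfold cartanT at h
  rw [h]

section measure

variable [MeasurableSpace Circle] [BorelSpace Circle]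

/-- **The eigen-identity in the form `∫_G g(x) φ_λ(y x) dν(x) = ĝ(λ) φ_λ(y)`** for bi-`K`-invariant
`g ∈ L¹(ν)` and `0 ≤ λ ≤ 2`. -/
theorem integral_mul_sph_mul {lam : ℝ} (h0 : 0 ≤ lam) (h2 : lam ≤ 2) {g : SU11 → ℝ}
    (hg : Integrable g (nu haarCircle))
    (hK : ∀ (u v : Circle) (x : SU11), g (rot u * x * rot v) = g x) (y : SU11) :
    ∫ x, g x * sph lam (y * x) ∂(nu haarCircle)
      = (∫ x, g x * sph lam x ∂(nu haarCircle)) * sph lam y := by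
  have hR : ∀ (x : SU11) (u : Circle), g (x * rot u) = g x := fun x u => by simpa using hK 1 u x
  rw [← integral_inv (nu haarCircle) (fun x => g x * sph lam (y * x))]
  have e : (fun x => g x⁻¹ * sph lam (y * x⁻¹)) = fun x => g x * sph lam (y * x⁻¹) := by
    funext x
    rw [biRotInvariant_inv hK]
  rw [e]
  exact integral_mul_sph_mul_inv (nu haarCircle) h0 h2 hg hR y

/-- The convolution integrand `(y, x) ↦ f(y) g(y⁻¹ x) φ_λ(x)` is integrable on `G × G` for continuous
`f, g ∈ L¹(ν)` and `0 ≤ λ ≤ 2`. -/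
theorem integrable_convolution_integrand {lam : ℝ} (h0 : 0 ≤ lam) (h2 : lam ≤ 2) {f g : SU11 → ℝ}
    (hfc : Continuous f) (hgc : Continuous g) (hf : Integrable f (nu haarCircle))
    (hg : Integrable g (nu haarCircle)) :
    Integrable (fun p : SU11 × SU11 => f p.1 * g (p.1⁻¹ * p.2) * sph lam p.2)
      ((nu haarCircle).prod (nu haarCircle)) := by
  have hcont : Continuous fun p : SU11 × SU11 => f p.1 * g (p.1⁻¹ * p.2) * sph lam p.2 :=
    ((hfc.comp continuous_fst).mul (hgc.comp (continuous_fst.inv.mul continuous_snd))).mul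
      ((continuous_sph lam).comp continuous_snd)
  refine (integrable_prod_iff hcont.aestronglyMeasurable).mpr
    ⟨Filter.Eventually.of_forall fun y => ?_, ?_⟩
  · show Integrable (fun x : SU11 => f y * g (y⁻¹ * x) * sph lam x) (nu haarCircle)
    have h1 : Integrable (fun x : SU11 => g (y⁻¹ * x)) (nu haarCircle) := hg.comp_mul_left y⁻¹
    have h2' : Integrable (fun x : SU11 => g (y⁻¹ * x) * sph lam x) (nu haarCircle) :=
      integrable_mul_sph _ h0 h2 h1
    have h3 := h2'.const_mul (f y)
    refine h3.congr (Filter.Eventually.of_forall fun x => ?_)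
    ring
  · show Integrable (fun y : SU11 => ∫ x, ‖f y * g (y⁻¹ * x) * sph lam x‖ ∂(nu haarCircle))
      (nu haarCircle)
    -- `∫_x ‖f y g(y⁻¹x) φ(x)‖ = ‖f y‖ ∫_x ‖g(y⁻¹x)‖ φ(x) ≤ ‖f y‖ ‖g‖₁`
    have e : ∀ y : SU11, ∫ x, ‖f y * g (y⁻¹ * x) * sph lam x‖ ∂(nu haarCircle)
        = ‖f y‖ * ∫ x, ‖g (y⁻¹ * x)‖ * sph lam x ∂(nu haarCircle) := by
      intro y
      rw [← integral_const_mul]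
      refine integral_congr_ae (Filter.Eventually.of_forall fun x => ?_)
      beta_reduce
      rw [norm_mul, norm_mul, Real.norm_eq_abs (sph lam x), abs_of_pos (sph_pos lam x)]
      ring
    have hb : ∀ y : SU11, ∫ x, ‖g (y⁻¹ * x)‖ * sph lam x ∂(nu haarCircle)
        ≤ ∫ x, ‖g x‖ ∂(nu haarCircle) := by
      intro y
      have h1 : Integrable (fun x : SU11 => g (y⁻¹ * x)) (nu haarCircle) := hg.comp_mul_left y⁻¹
      calc ∫ x, ‖g (y⁻¹ * x)‖ * sph lam x ∂(nu haarCircle)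
          ≤ ∫ x, ‖g (y⁻¹ * x)‖ ∂(nu haarCircle) := by
            refine integral_mono (integrable_mul_sph _ h0 h2 h1.norm) h1.norm fun x => ?_
            simp only
            calc ‖g (y⁻¹ * x)‖ * sph lam x ≤ ‖g (y⁻¹ * x)‖ * 1 :=
                  mul_le_mul_of_nonneg_left (sph_le_one h0 h2 x) (norm_nonneg _)
              _ = ‖g (y⁻¹ * x)‖ := mul_one _
        _ = ∫ x, ‖g x‖ ∂(nu haarCircle) :=
            integral_mul_left_eq_self (fun x => ‖g x‖) y⁻¹
    have hmeas : AEStronglyMeasurable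
        (fun y : SU11 => ∫ x, ‖f y * g (y⁻¹ * x) * sph lam x‖ ∂(nu haarCircle)) (nu haarCircle) :=
      hcont.aestronglyMeasurable.norm.integral_prod_right'
    refine (hf.norm.const_mul (∫ x, ‖g x‖ ∂(nu haarCircle))).mono' hmeas
      (Filter.Eventually.of_forall fun y => ?_)
    rw [Real.norm_eq_abs, abs_of_nonneg (integral_nonneg fun x => norm_nonneg _), e y, mul_comm]
    exact mul_le_mul_of_nonneg_right (hb y) (norm_nonneg _)

/-- `∫_G g(y⁻¹ x) φ_λ(x) dν(x) = ĝ(λ) φ_λ(y)` (left translation + the eigen-identity). -/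
theorem integral_mul_sph_inv_mul' {lam : ℝ} (h0 : 0 ≤ lam) (h2 : lam ≤ 2) {g : SU11 → ℝ}
    (hg : Integrable g (nu haarCircle))
    (hK : ∀ (u v : Circle) (x : SU11), g (rot u * x * rot v) = g x) (y : SU11) :
    ∫ x, g (y⁻¹ * x) * sph lam x ∂(nu haarCircle)
      = (∫ x, g x * sph lam x ∂(nu haarCircle)) * sph lam y := by
  rw [← integral_mul_sph_mul h0 h2 hg hK y,
    ← integral_mul_left_eq_self (fun x => g x * sph lam (y * x)) y⁻¹]
  refine integral_congr_ae (Filter.Eventually.of_forall fun x => ?_)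
  beta_reduce
  rw [mul_inv_cancel_left]

/-- **THE CONVOLUTION THEOREM**: for continuous bi-`K`-invariant `f, g ∈ L¹(ν)` and `0 ≤ λ ≤ 2`,
`∫_G (∫_G f(y) g(y⁻¹ x) dν(y)) φ_λ(x) dν(x) = (∫_G f φ_λ dν) (∫_G g φ_λ dν)`. -/
theorem integral_convolution_mul_sph {lam : ℝ} (h0 : 0 ≤ lam) (h2 : lam ≤ 2) {f g : SU11 → ℝ}
    (hfc : Continuous f) (hgc : Continuous g) (hf : Integrable f (nu haarCircle))
    (hg : Integrable g (nu haarCircle))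
    (hKg : ∀ (u v : Circle) (x : SU11), g (rot u * x * rot v) = g x) :
    ∫ x, (∫ y, f y * g (y⁻¹ * x) ∂(nu haarCircle)) * sph lam x ∂(nu haarCircle)
      = (∫ x, f x * sph lam x ∂(nu haarCircle)) * ∫ x, g x * sph lam x ∂(nu haarCircle) := by
  have hint := integrable_convolution_integrand h0 h2 hfc hgc hf hg (lam := lam)
  have e1 : ∫ x, (∫ y, f y * g (y⁻¹ * x) ∂(nu haarCircle)) * sph lam x ∂(nu haarCircle)
      = ∫ x, ∫ y, f y * g (y⁻¹ * x) * sph lam x ∂(nu haarCircle) ∂(nu haarCircle) := by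
    congr 1
    funext x
    rw [← integral_mul_const]
  rw [e1, ← integral_prod_symm _ hint, integral_prod _ hint]
  have e2 : ∀ y : SU11, ∫ x, f y * g (y⁻¹ * x) * sph lam x ∂(nu haarCircle)
      = (∫ x, g x * sph lam x ∂(nu haarCircle)) * (f y * sph lam y) := by
    intro y
    have : ∫ x, f y * g (y⁻¹ * x) * sph lam x ∂(nu haarCircle)
        = f y * ∫ x, g (y⁻¹ * x) * sph lam x ∂(nu haarCircle) := by
      rw [← integral_const_mul]
      congr 1
      funext x
      ring
    rw [this, integral_mul_sph_inv_mul' h0 h2 hg hKg y]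
    ring
  simp_rw [e2]
  rw [integral_const_mul, mul_comm]

/-- **Commutativity at the level of transforms**: the transforms of `f ∗ g` and `g ∗ f` agree. -/
theorem integral_convolution_mul_sph_comm {lam : ℝ} (h0 : 0 ≤ lam) (h2 : lam ≤ 2) {f g : SU11 → ℝ}
    (hfc : Continuous f) (hgc : Continuous g) (hf : Integrable f (nu haarCircle))
    (hg : Integrable g (nu haarCircle))
    (hKf : ∀ (u v : Circle) (x : SU11), f (rot u * x * rot v) = f x)
    (hKg : ∀ (u v : Circle) (x : SU11), g (rot u * x * rot v) = g x) :
    ∫ x, (∫ y, f y * g (y⁻¹ * x) ∂(nu haarCircle)) * sph lam x ∂(nu haarCircle)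
      = ∫ x, (∫ y, g y * f (y⁻¹ * x) ∂(nu haarCircle)) * sph lam x ∂(nu haarCircle) := by
  rw [integral_convolution_mul_sph h0 h2 hfc hgc hf hg hKg,
    integral_convolution_mul_sph h0 h2 hgc hfc hg hf hKf, mul_comm]

end measure

end Summit.Ventures.HodgeRepro2.T5SU11SphericalConvolution
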